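import Literature.Analysis.Complex.BochnerTubeGrowth
import Literature.Analysis.Complex.RealEnvironment
import Mathlib.Analysis.SpecialFunctions.Complex.LogDeriv
import Mathlib.Analysis.SpecialFunctions.Complex.Arg
import HarnessLib

/-!
# Bochner's tube theorem in polar form: argument regions `{(arg ζᵢ)ᵢ ∈ B}`

Analysis/Complex support file (everything proved; no definitions, no named facts), sequel of
`BochnerTubeGrowth`. Osterwalder–Schrader II (Comm. Math. Phys. 42 (1975), Ch. V.2, (5.22)) work
with the regions `C_k^{(N)} = {ζ ∈ ℂ₊ᵏ | (arg ζ₁, …, arg ζ_k) ∈ c_k^{(N)}}` of the product of right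
half-planes and pass to tubes by `ζᵢ = e^{wᵢ}`: "the regions `C_k^{(N)}` … are mapped onto tubular
domains under the transformation `ζᵢ = e^{wᵢ}` … we define `c_k^{(N)}` … to be the bases of these
tubes". This file performs that change of variables once and for all:

* `exists_holomorphic_extension_argRegion_convexHull` — let `B ⊆ (-π/2, π/2)ᵏ` be open and
  star-shaped with respect to `0 ∈ B`, and `f` holomorphic on the **argument region**
  `{ζ | Re ζᵢ > 0, (arg ζᵢ)ᵢ ∈ B}` with `|f(ζ)| ≤ C_K (∏ᵢ (|ζᵢ| + |ζᵢ|⁻¹))^p` whenever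
  `(arg ζᵢ)ᵢ` lies in a compact `K ⊆ B`. Then `f` extends to a holomorphic function on the
  argument region of the **convex hull** `conv B`, with the same kind of bound (some exponent `p'`),
  equal to `f` on the region of `B`, and unique (the tube theorem of `BochnerTubeGrowth` in the
  variables `w = log ζ`; the growth classes "polynomial in `|ζᵢ|^{±1}`" and "exponential in `Re w`"
  correspond).
* Topology and gluing on argument regions: `isOpen_argRegion`, `isPreconnected_argRegion`
  (image of a convex tube under `exp`), `ofReal_mem_argRegion`, the identity theorem from the
  positive real points `eqOn_argRegion_of_eqOn_posReal` (real environments), and the elementary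
  gluing of pairwise compatible holomorphic functions on a union of open sets
  `exists_differentiableOn_iUnion_of_eqOn_inter` — the bookkeeping of the step (A_N) of OS II
  ("this analytically extends `S_k` to `C_k^{(M)}'` and hence, because `C_k^{(M)}` is the envelope
  of holomorphy of `C_k^{(M)}'`, … into `C_k^{(M)}`").

The sets are written out (`{ζ | (∀ i, 0 < (ζ i).re) ∧ (fun i => (ζ i).arg) ∈ B}`) rather than
named, so that the statement applies verbatim to the bases `osBaseC N k ⊆ (-π/2, π/2)ᵏ` of
`Literature/MathematicalPhysics/QuantumFieldTheory/OSEnvelopeBases.lean` (open for `N ≥ 1`,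
convex, containing `0`, with `osBaseC (N+1) k = convexHull ℝ (osGen (osBaseD N) k)` and the
generating set star-shaped: `starConvex_osGen_osBaseD`, `isOpen_osGen_osBaseD_succ`).

## References

* K. Osterwalder, R. Schrader, *Axioms for Euclidean Green's functions II*, Comm. Math. Phys. 42
  (1975) 281–305, Ch. V.1 (5.8), Ch. V.2 (5.15), (5.22)–(5.23). [OsterwalderSchraderCMP1975]
-/

noncomputable section

open _root_.Complex Set Filter Metric Real
open scoped _root_.Topology

namespace Literature.Analysis.Complex

open TubeFourier

variable {k : ℕ}

/-! ### Elementary lemmas -/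

/-- The open cube `{|vᵢ| < c}` is convex. [folklore] -/
theorem convex_setOf_forall_abs_lt (c : ℝ) : Convex ℝ {v : Fin k → ℝ | ∀ i, |v i| < c} := by
  have : {v : Fin k → ℝ | ∀ i, |v i| < c} = Set.pi univ fun _ => Ioo (-c) c := by
    ext v; simp [abs_lt]
  rw [this]
  exact convex_pi fun i _ => convex_Ioo _ _

/-- `eˣ + e⁻ˣ ≤ 2 e^{|x|}`. [folklore] -/
theorem exp_add_exp_neg_le (x : ℝ) : Real.exp x + Real.exp (-x) ≤ 2 * Real.exp |x| := by
  have h1 : Real.exp x ≤ Real.exp |x| := Real.exp_le_exp.2 (le_abs_self x)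
  have h2 : Real.exp (-x) ≤ Real.exp |x| := Real.exp_le_exp.2 (neg_le_abs x)
  linarith

/-- `e^{|log r|} ≤ r + r⁻¹` for `r > 0`. [folklore] -/
theorem exp_abs_log_le {r : ℝ} (hr : 0 < r) : Real.exp |Real.log r| ≤ r + r⁻¹ := by
  rcases le_or_gt 0 (Real.log r) with h | h
  · rw [abs_of_nonneg h, Real.exp_log hr]
    linarith [inv_pos.2 hr]
  · rw [abs_of_neg h, Real.exp_neg, Real.exp_log hr]
    linarith

/-- For `|Im w| < π/2`: `Re eʷ > 0` and `arg eʷ = Im w`. [folklore] -/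
theorem re_exp_pos_and_arg_exp {w : ℂ} (hw : |w.im| < π / 2) :
    0 < (Complex.exp w).re ∧ Complex.arg (Complex.exp w) = w.im := by
  have h1 := abs_lt.1 hw
  refine ⟨?_, ?_⟩
  · rw [Complex.exp_re]
    exact mul_pos (Real.exp_pos _) (Real.cos_pos_of_mem_Ioo ⟨by linarith, by linarith⟩)
  · rw [← Complex.log_im, Complex.log_exp (by linarith [Real.pi_pos]) (by linarith [Real.pi_pos])]

/-- For `Re ζ > 0`: `log ζ` has imaginary part `arg ζ ∈ (-π/2, π/2)` and `e^{log ζ} = ζ`. [folklore] -/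
theorem abs_log_im_lt_of_re_pos {ζ : ℂ} (hζ : 0 < ζ.re) : |(Complex.log ζ).im| < π / 2 := by
  rw [Complex.log_im]
  exact Complex.abs_arg_lt_pi_div_two_iff.2 (Or.inl hζ)

/-! ### The theorem -/

/-- **Bochner's tube theorem for argument regions** (the change of variables `ζᵢ = e^{wᵢ}` of
OS II (5.22) applied to `exists_holomorphic_extension_tube_convexHull_of_expGrowth`). Let
`B ⊆ (-π/2, π/2)ᵏ` be open and star-shaped with respect to `0 ∈ B`, `f` holomorphic on
`{ζ | Re ζᵢ > 0, (arg ζᵢ)ᵢ ∈ B}` with `‖f ζ‖ ≤ C_K (∏ᵢ (‖ζᵢ‖ + ‖ζᵢ‖⁻¹))^p` for `(arg ζᵢ)ᵢ` in any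
compact `K ⊆ B` (one exponent `p`). Then `f` extends holomorphically to
`{ζ | Re ζᵢ > 0, (arg ζᵢ)ᵢ ∈ conv B}`, with the same kind of bound, uniquely. [cite: OsterwalderSchraderCMP1975, Ch. V.2 (5.22)–(5.23)] -/
theorem exists_holomorphic_extension_argRegion_convexHull {B : Set (Fin k → ℝ)} (hBo : IsOpen B)
    (h0 : (0 : Fin k → ℝ) ∈ B) (hst : StarConvex ℝ 0 B) (hB : B ⊆ {v | ∀ i, |v i| < π / 2})
    {f : (Fin k → ℂ) → ℂ}
    (hf : DifferentiableOn ℂ f {ζ | (∀ i, 0 < (ζ i).re) ∧ (fun i => (ζ i).arg) ∈ B})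
    (hgr : ∃ p : ℕ, ∀ K ⊆ B, IsCompact K → ∃ C : ℝ, ∀ ζ : Fin k → ℂ, (∀ i, 0 < (ζ i).re) →
      (fun i => (ζ i).arg) ∈ K → ‖f ζ‖ ≤ C * (∏ i, (‖ζ i‖ + ‖ζ i‖⁻¹)) ^ p) :
    ∃ fext : (Fin k → ℂ) → ℂ,
      DifferentiableOn ℂ fext {ζ | (∀ i, 0 < (ζ i).re) ∧ (fun i => (ζ i).arg) ∈ convexHull ℝ B} ∧
      EqOn fext f {ζ | (∀ i, 0 < (ζ i).re) ∧ (fun i => (ζ i).arg) ∈ B} ∧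
      (∃ p' : ℕ, ∀ K ⊆ convexHull ℝ B, IsCompact K → ∃ C : ℝ, ∀ ζ : Fin k → ℂ,
        (∀ i, 0 < (ζ i).re) → (fun i => (ζ i).arg) ∈ K →
        ‖fext ζ‖ ≤ C * (∏ i, (‖ζ i‖ + ‖ζ i‖⁻¹)) ^ p') ∧
      ∀ f' : (Fin k → ℂ) → ℂ,
        DifferentiableOn ℂ f' {ζ | (∀ i, 0 < (ζ i).re) ∧ (fun i => (ζ i).arg) ∈ convexHull ℝ B} →
        EqOn f' f {ζ | (∀ i, 0 < (ζ i).re) ∧ (fun i => (ζ i).arg) ∈ B} →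
        EqOn f' fext {ζ | (∀ i, 0 < (ζ i).re) ∧ (fun i => (ζ i).arg) ∈ convexHull ℝ B} := by
  classical
  -- the cube and the hull
  have hcubec : Convex ℝ {v : Fin k → ℝ | ∀ i, |v i| < π / 2} := convex_setOf_forall_abs_lt _
  have hHB : convexHull ℝ B ⊆ {v : Fin k → ℝ | ∀ i, |v i| < π / 2} := convexHull_min hB hcubec
  -- Euclidean coordinates for the tube theorem
  set e : EuclideanSpace ℝ (Fin k) ≃L[ℝ] (Fin k → ℝ) := EuclideanSpace.equiv (Fin k) ℝ with he
  have he_apply : ∀ (y : EuclideanSpace ℝ (Fin k)) (j : Fin k), e y j = y j := fun y j => rfl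
  set B' : Set (EuclideanSpace ℝ (Fin k)) := e ⁻¹' B with hB'
  have hB'o : IsOpen B' := hBo.preimage e.continuous
  have h0' : (0 : EuclideanSpace ℝ (Fin k)) ∈ B' := by
    show e 0 ∈ B; rw [map_zero]; exact h0
  have hst' : StarConvex ℝ (0 : EuclideanSpace ℝ (Fin k)) B' := by
    have := StarConvex.linear_preimage (s := B) (e : EuclideanSpace ℝ (Fin k) →ₗ[ℝ] (Fin k → ℝ))
      (by rw [show ((e : EuclideanSpace ℝ (Fin k) →ₗ[ℝ] (Fin k → ℝ)) 0) = 0 from map_zero _]; exact hst)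
    exact this
  have hB'b : Bornology.IsBounded B' := by
    rw [isBounded_iff_forall_norm_le]
    refine ⟨∑ _i : Fin k, π / 2, fun y hy => ?_⟩
    refine (norm_le_sum_abs_euclidean y).trans (Finset.sum_le_sum fun j _ => ?_)
    exact (hB hy j).le
  -- the hull in Euclidean coordinates
  have hconv : convexHull ℝ B' = e ⁻¹' convexHull ℝ B := by
    rw [hB', ← ContinuousLinearEquiv.image_symm_eq_preimage,
      ← ContinuousLinearEquiv.image_symm_eq_preimage]
    exact (LinearMap.image_convexHull (e.symm : (Fin k → ℝ) →ₗ[ℝ] EuclideanSpace ℝ (Fin k)) B).symm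
  -- exp and log
  have hexp : ∀ w : Fin k → ℂ, (fun j => (w j).im) ∈ convexHull ℝ B →
      (∀ j, 0 < (Complex.exp (w j)).re) ∧ (fun j => (Complex.exp (w j)).arg) = fun j => (w j).im := by
    intro w hw
    have h := fun j => re_exp_pos_and_arg_exp (hHB hw j)
    exact ⟨fun j => (h j).1, funext fun j => (h j).2⟩
  have hlog : ∀ ζ : Fin k → ℂ, (∀ j, 0 < (ζ j).re) →
      (fun j => (Complex.log (ζ j)).im) = (fun j => (ζ j).arg) ∧
      (fun j => Complex.exp (Complex.log (ζ j))) = ζ := by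
    intro ζ hζ
    refine ⟨funext fun j => Complex.log_im _, funext fun j => Complex.exp_log ?_⟩
    intro h; have := hζ j; rw [h] at this; simp at this
  -- tube membership in terms of imaginary parts
  have hmem_tube : ∀ (S : Set (Fin k → ℝ)) (w : Fin k → ℂ), w ∈ tube (e ⁻¹' S) ↔ (fun j => (w j).im) ∈ S := by
    intro S w
    rw [mem_tube, Set.mem_preimage]
    exact Iff.of_eq (congrArg (· ∈ S) (funext fun j => by rw [he_apply, imv_apply]))
  -- the function in tube coordinates
  set g : (Fin k → ℂ) → ℂ := fun w => f fun j => Complex.exp (w j) with hg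
  have hexp_d : Differentiable ℂ fun w : Fin k → ℂ => (fun j => Complex.exp (w j)) :=
    differentiable_pi.2 fun j => Complex.differentiable_exp.comp (differentiable_apply j)
  have hBsubH : B ⊆ convexHull ℝ B := subset_convexHull ℝ B
  have hgd : DifferentiableOn ℂ g (tube B') := by
    refine hf.comp hexp_d.differentiableOn fun w hw => ?_
    have hw' : (fun j => (w j).im) ∈ B := (hmem_tube B w).1 hw
    obtain ⟨hre, harg⟩ := hexp w (hBsubH hw')
    exact ⟨hre, by rw [harg]; exact hw'⟩
  -- growth in tube coordinates
  obtain ⟨p, hp⟩ := hgr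
  have hggr : ∃ a : ℝ, ∀ K' ⊆ B', IsCompact K' → ∃ C : ℝ, ∀ x, ∀ y ∈ K',
      ‖g (cpt x y)‖ ≤ C * Real.exp (a * ‖x‖) := by
    refine ⟨p * k, fun K' hK' hK'c => ?_⟩
    obtain ⟨C, hC⟩ := hp (e '' K') (by rintro _ ⟨y, hy, rfl⟩; exact hK' hy) (hK'c.image e.continuous)
    refine ⟨max C 0 * (2 : ℝ) ^ (k * p), fun x y hy => ?_⟩
    have hyB : (fun j => (cpt x y j).im) ∈ convexHull ℝ B := by
      have : (fun j => (cpt x y j).im) = e y := funext fun j => by simp [he_apply]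
      rw [this]; exact hBsubH (hK' hy)
    obtain ⟨hre, harg⟩ := hexp (cpt x y) hyB
    have hargK : (fun j => (Complex.exp (cpt x y j)).arg) ∈ e '' K' := by
      rw [harg]; exact ⟨y, hy, funext fun j => by simp [he_apply]⟩
    have h1 := hC _ hre hargK
    -- `∏ (|ζⱼ| + |ζⱼ|⁻¹) = ∏ (e^{xⱼ} + e^{-xⱼ}) ≤ 2^k e^{Σ|xⱼ|}`
    have hprod : (∏ j, (‖Complex.exp (cpt x y j)‖ + ‖Complex.exp (cpt x y j)‖⁻¹)) ≤
        (2 : ℝ) ^ k * Real.exp (k * ‖x‖) := by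
      have hfac : ∀ j, ‖Complex.exp (cpt x y j)‖ + ‖Complex.exp (cpt x y j)‖⁻¹ ≤ 2 * Real.exp ‖x‖ := by
        intro j
        rw [Complex.norm_exp, ← Real.exp_neg]
        simp only [cpt_apply, Complex.add_re, Complex.ofReal_re, Complex.mul_re, Complex.I_re,
          Complex.I_im, Complex.ofReal_im, mul_zero, zero_mul, sub_zero, add_zero]
        refine (exp_add_exp_neg_le (x j)).trans ?_
        gcongr
        exact abs_apply_le_norm_euclidean x j
      calc (∏ j, (‖Complex.exp (cpt x y j)‖ + ‖Complex.exp (cpt x y j)‖⁻¹))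
          ≤ ∏ _j : Fin k, 2 * Real.exp ‖x‖ :=
            Finset.prod_le_prod (fun j _ => by positivity) fun j _ => hfac j
        _ = (2 : ℝ) ^ k * Real.exp (k * ‖x‖) := by
            rw [Finset.prod_const, Finset.card_univ, Fintype.card_fin, mul_pow, ← Real.exp_nat_mul]
    calc ‖g (cpt x y)‖ = ‖f fun j => Complex.exp (cpt x y j)‖ := rfl
      _ ≤ C * (∏ j, (‖Complex.exp (cpt x y j)‖ + ‖Complex.exp (cpt x y j)‖⁻¹)) ^ p := h1
      _ ≤ max C 0 * ((2 : ℝ) ^ k * Real.exp (k * ‖x‖)) ^ p := by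
          refine le_trans (mul_le_mul_of_nonneg_right (le_max_left C 0) (by positivity)) ?_
          refine mul_le_mul_of_nonneg_left ?_ (le_max_right C 0)
          exact pow_le_pow_left₀ (by positivity) hprod p
      _ = max C 0 * (2 : ℝ) ^ (k * p) * Real.exp (↑p * ↑k * ‖x‖) := by
          rw [mul_pow, ← pow_mul, ← Real.exp_nat_mul]
          ring_nf
  -- the tube theorem
  obtain ⟨gext, hgext_d, hgext_eq, ⟨a', hgext_gr⟩, hgext_uniq⟩ :=
    exists_holomorphic_extension_tube_convexHull_of_expGrowth hB'o h0' hst' hB'b hgd hggr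
  -- back to the argument region
  have hlog_d : DifferentiableOn ℂ (fun ζ : Fin k → ℂ => fun j => Complex.log (ζ j))
      {ζ | ∀ j, 0 < (ζ j).re} := by
    refine differentiableOn_pi.2 fun j ζ hζ => ?_
    exact ((differentiableAt_apply (𝕜 := ℂ) j ζ).clog
      (Complex.mem_slitPlane_iff.2 (Or.inl (hζ j)))).differentiableWithinAt
  have hlog_mem : ∀ (S : Set (Fin k → ℝ)) (ζ : Fin k → ℂ), (∀ j, 0 < (ζ j).re) →
      (fun j => (ζ j).arg) ∈ S → (fun j => Complex.log (ζ j)) ∈ tube (e ⁻¹' S) := by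
    intro S ζ hζ hS
    rw [hmem_tube, (hlog ζ hζ).1]; exact hS
  refine ⟨fun ζ => gext fun j => Complex.log (ζ j), ?_, ?_, ?_, ?_⟩
  · -- holomorphy
    refine hgext_d.comp (hlog_d.mono fun ζ hζ => hζ.1) fun ζ hζ => ?_
    rw [hconv]; exact hlog_mem _ ζ hζ.1 hζ.2
  · -- agreement with `f`
    intro ζ hζ
    show gext (fun j => Complex.log (ζ j)) = f ζ
    rw [hgext_eq (hlog_mem B ζ hζ.1 hζ.2), hg]
    simp only
    rw [(hlog ζ hζ.1).2]
  · -- growth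
    set ap : ℝ := max a' 0 with hap
    refine ⟨⌈ap⌉₊, fun K hK hKc => ?_⟩
    obtain ⟨C', hC'⟩ := hgext_gr (e ⁻¹' K) (by rw [hconv]; exact preimage_mono hK)
      (by rw [← ContinuousLinearEquiv.image_symm_eq_preimage]; exact hKc.image e.symm.continuous)
    refine ⟨max C' 0, fun ζ hζ hζK => ?_⟩
    -- write `log ζ = x + iy`
    set x : EuclideanSpace ℝ (Fin k) := e.symm fun j => Real.log ‖ζ j‖ with hx
    set y : EuclideanSpace ℝ (Fin k) := e.symm fun j => (ζ j).arg with hy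
    have hxj : ∀ j, x j = Real.log ‖ζ j‖ := fun j => by
      rw [← he_apply, hx, ContinuousLinearEquiv.apply_symm_apply]
    have hyj : ∀ j, y j = (ζ j).arg := fun j => by
      rw [← he_apply, hy, ContinuousLinearEquiv.apply_symm_apply]
    have hcpt : cpt x y = fun j => Complex.log (ζ j) := by
      funext j
      apply Complex.ext
      · simp [cpt_apply, hxj, Complex.log_re]
      · simp [cpt_apply, hyj, Complex.log_im]
    have hyK : y ∈ e ⁻¹' K := by
      show e y ∈ K
      have : e y = fun j => (ζ j).arg := funext fun j => by rw [he_apply, hyj]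
      rw [this]; exact hζK
    have h1 := hC' x y hyK
    rw [hcpt] at h1
    -- `e^{a'‖x‖} ≤ ∏ (|ζⱼ| + |ζⱼ|⁻¹)^{⌈a⁺⌉}`
    have hζ0 : ∀ j, 0 < ‖ζ j‖ := fun j => norm_pos_iff.2 fun h => by
      have := hζ j; rw [h] at this; simp at this
    have hexp_le : Real.exp (a' * ‖x‖) ≤ (∏ j, (‖ζ j‖ + ‖ζ j‖⁻¹)) ^ ⌈ap⌉₊ := by
      have hap0 : 0 ≤ ap := le_max_right _ _
      have hceil : ap ≤ ⌈ap⌉₊ := Nat.le_ceil ap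
      calc Real.exp (a' * ‖x‖) ≤ Real.exp (⌈ap⌉₊ * ∑ j, |x j|) := by
            refine Real.exp_le_exp.2 ?_
            calc a' * ‖x‖ ≤ ap * ‖x‖ := mul_le_mul_of_nonneg_right (le_max_left _ _) (norm_nonneg _)
              _ ≤ ⌈ap⌉₊ * ∑ j, |x j| :=
                  mul_le_mul hceil (norm_le_sum_abs_euclidean x) (norm_nonneg _) (by positivity)
        _ = ∏ j, Real.exp |x j| ^ ⌈ap⌉₊ := by
            rw [Finset.mul_sum, Real.exp_sum]
            refine Finset.prod_congr rfl fun j _ => ?_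
            rw [← Real.exp_nat_mul]
        _ ≤ ∏ j, (‖ζ j‖ + ‖ζ j‖⁻¹) ^ ⌈ap⌉₊ := by
            refine Finset.prod_le_prod (fun j _ => by positivity) fun j _ => ?_
            refine pow_le_pow_left₀ (Real.exp_pos _).le ?_ _
            rw [hxj]
            exact exp_abs_log_le (hζ0 j)
        _ = (∏ j, (‖ζ j‖ + ‖ζ j‖⁻¹)) ^ ⌈ap⌉₊ := Finset.prod_pow _ _ _
    calc ‖gext fun j => Complex.log (ζ j)‖ ≤ C' * Real.exp (a' * ‖x‖) := h1
      _ ≤ max C' 0 * Real.exp (a' * ‖x‖) :=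
          mul_le_mul_of_nonneg_right (le_max_left _ _) (Real.exp_pos _).le
      _ ≤ max C' 0 * (∏ j, (‖ζ j‖ + ‖ζ j‖⁻¹)) ^ ⌈ap⌉₊ :=
          mul_le_mul_of_nonneg_left hexp_le (le_max_right _ _)
  · -- uniqueness
    intro f' hf'd hf'eq ζ hζ
    have hq : EqOn (fun w => f' fun j => Complex.exp (w j)) gext (tube (convexHull ℝ B')) := by
      refine hgext_uniq _ ?_ ?_
      · refine hf'd.comp hexp_d.differentiableOn fun w hw => ?_
        rw [hconv, hmem_tube] at hw
        obtain ⟨hre, harg⟩ := hexp w hw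
        exact ⟨hre, by rw [harg]; exact hw⟩
      · intro w hw
        have hw' : (fun j => (w j).im) ∈ B := (hmem_tube B w).1 hw
        obtain ⟨hre, harg⟩ := hexp w (hBsubH hw')
        show f' (fun j => Complex.exp (w j)) = g w
        rw [hg]
        exact hf'eq ⟨hre, by rw [harg]; exact hw'⟩
    have hw : (fun j => Complex.log (ζ j)) ∈ tube (convexHull ℝ B') := by
      rw [hconv]; exact hlog_mem _ ζ hζ.1 hζ.2
    have := hq hw
    simp only at this
    rw [(hlog ζ hζ.1).2] at this
    exact this

/-! ### Argument regions: topology, real points, identity theorem, gluing -/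

/-- The vector of arguments is continuous on the product of open right half-planes. [folklore] -/
theorem continuousOn_argVec :
    ContinuousOn (fun ζ : Fin k → ℂ => fun i => (ζ i).arg) {ζ | ∀ i, 0 < (ζ i).re} := by
  refine continuousOn_pi.2 fun i ζ hζ => ?_
  have h1 : ContinuousAt (fun p : Fin k → ℂ => p i) ζ := (continuous_apply i).continuousAt
  have h2 : ContinuousAt Complex.arg (ζ i) :=
    Complex.continuousAt_arg (Complex.mem_slitPlane_iff.2 (Or.inl (hζ i)))
  exact (ContinuousAt.comp (x := ζ) h2 h1).continuousWithinAt

/-- The product of open right half-planes is open. [folklore] -/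
theorem isOpen_setOf_forall_re_pos : IsOpen {ζ : Fin k → ℂ | ∀ i, 0 < (ζ i).re} := by
  have : {ζ : Fin k → ℂ | ∀ i, 0 < (ζ i).re} = ⋂ i, {ζ | 0 < (ζ i).re} := by ext; simp
  rw [this]
  exact isOpen_iInter_of_finite fun i =>
    isOpen_lt continuous_const (Complex.continuous_re.comp (continuous_apply i))

/-- **Argument regions over open bases are open.** [folklore] -/
theorem isOpen_argRegion {B : Set (Fin k → ℝ)} (hBo : IsOpen B) :
    IsOpen {ζ : Fin k → ℂ | (∀ i, 0 < (ζ i).re) ∧ (fun i => (ζ i).arg) ∈ B} :=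
  continuousOn_argVec.isOpen_inter_preimage isOpen_setOf_forall_re_pos hBo

/-- **Argument regions over bases in the cube are images of tubes under `exp`.** [folklore] -/
theorem argRegion_eq_image_cexp {B : Set (Fin k → ℝ)} (hB : B ⊆ {v | ∀ i, |v i| < π / 2}) :
    {ζ : Fin k → ℂ | (∀ i, 0 < (ζ i).re) ∧ (fun i => (ζ i).arg) ∈ B} =
      (fun w : Fin k → ℂ => fun j => Complex.exp (w j)) '' {w | (fun j => (w j).im) ∈ B} := by
  ext ζ
  constructor
  · rintro ⟨hre, harg⟩
    refine ⟨fun j => Complex.log (ζ j), ?_, funext fun j => Complex.exp_log ?_⟩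
    · show (fun j => (Complex.log (ζ j)).im) ∈ B
      simp only [Complex.log_im]; exact harg
    · intro h; have := hre j; rw [h] at this; simp at this
  · rintro ⟨w, hw, rfl⟩
    have h := fun j => re_exp_pos_and_arg_exp (hB hw j)
    refine ⟨fun j => (h j).1, ?_⟩
    show (fun j => (Complex.exp (w j)).arg) ∈ B
    rw [show (fun j => (Complex.exp (w j)).arg) = fun j => (w j).im from funext fun j => (h j).2]
    exact hw

/-- **Argument regions over convex bases in the cube are (pre)connected.** [folklore] -/
theorem isPreconnected_argRegion {B : Set (Fin k → ℝ)} (hBc : Convex ℝ B)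
    (hB : B ⊆ {v | ∀ i, |v i| < π / 2}) :
    IsPreconnected {ζ : Fin k → ℂ | (∀ i, 0 < (ζ i).re) ∧ (fun i => (ζ i).arg) ∈ B} := by
  rw [argRegion_eq_image_cexp hB]
  refine IsPreconnected.image ?_ _ ?_
  · refine Convex.isPreconnected ?_
    intro w hw w' hw' a b ha hb hab
    show (fun j => ((a • w + b • w') j).im) ∈ B
    have : (fun j => ((a • w + b • w') j).im) = a • (fun j => (w j).im) + b • (fun j => (w' j).im) := by
      funext j; simp
    rw [this]
    exact hBc hw hw' ha hb hab
  · have hd : Differentiable ℂ fun w : Fin k → ℂ => (fun j => Complex.exp (w j)) :=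
      differentiable_pi.2 fun j => Complex.differentiable_exp.comp (differentiable_apply (𝕜 := ℂ) j)
    exact hd.continuous.continuousOn

/-- **Positive real points lie in every argument region whose base contains `0`.** [folklore] -/
theorem ofReal_mem_argRegion {B : Set (Fin k → ℝ)} (h0 : (0 : Fin k → ℝ) ∈ B) {η : Fin k → ℝ}
    (hη : ∀ i, 0 < η i) :
    (fun i => (η i : ℂ)) ∈ {ζ : Fin k → ℂ | (∀ i, 0 < (ζ i).re) ∧ (fun i => (ζ i).arg) ∈ B} := by
  refine ⟨fun i => by simpa using hη i, ?_⟩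
  show (fun i => ((η i : ℂ)).arg) ∈ B
  rw [show (fun i => ((η i : ℂ)).arg) = 0 from funext fun i => Complex.arg_ofReal_of_nonneg (hη i).le]
  exact h0

/-- **Identity theorem on argument regions from the positive real points**: two holomorphic
functions on the argument region of a convex open base `B ∋ 0` in the cube which agree at all
positive real points agree on the region (real environments, Streater–Wightman §2-3; the
consistency of the continuations of OS II (A_N), which all restrict to the same `S_k` on
`ℝ₊ᵏ`). [cite: StreaterWightman1964, §2-3 (pdf p. 46)] -/
theorem eqOn_argRegion_of_eqOn_posReal {B : Set (Fin k → ℝ)} (hBo : IsOpen B) (hBc : Convex ℝ B)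
    (h0 : (0 : Fin k → ℝ) ∈ B) (hB : B ⊆ {v | ∀ i, |v i| < π / 2}) {f g : (Fin k → ℂ) → ℂ}
    (hf : DifferentiableOn ℂ f {ζ | (∀ i, 0 < (ζ i).re) ∧ (fun i => (ζ i).arg) ∈ B})
    (hg : DifferentiableOn ℂ g {ζ | (∀ i, 0 < (ζ i).re) ∧ (fun i => (ζ i).arg) ∈ B})
    (h : ∀ η : Fin k → ℝ, (∀ i, 0 < η i) → f (fun i => (η i : ℂ)) = g (fun i => (η i : ℂ))) :
    EqOn f g {ζ | (∀ i, 0 < (ζ i).re) ∧ (fun i => (ζ i).arg) ∈ B} := by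
  set U := {ζ : Fin k → ℂ | (∀ i, 0 < (ζ i).re) ∧ (fun i => (ζ i).arg) ∈ B} with hU
  have hUo : IsOpen U := isOpen_argRegion hBo
  have hUc : IsPreconnected U := isPreconnected_argRegion hBc hB
  have h1 : (fun _ : Fin k => ((1 : ℝ) : ℂ)) ∈ U := ofReal_mem_argRegion h0 fun _ => one_pos
  obtain ⟨ρ, hρ, hball⟩ := Metric.isOpen_iff.1 hUo _ h1
  have hfg : DifferentiableOn ℂ (fun ζ => f ζ - g ζ) U := hf.sub hg
  have han : AnalyticOnNhd ℂ (fun ζ => f ζ - g ζ) U := SCV.analyticOnNhd_of_differentiableOn hfg hUo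
  have hev : ∀ᶠ z in 𝓝 (fun _ : Fin k => ((1 : ℝ) : ℂ)), f z - g z = 0 := by
    refine SCV.eventually_eq_zero_of_eq_zero_on_reals_pi hρ (hfg.mono hball) fun w hw => ?_
    have hwU : (fun i => (w i : ℂ)) ∈ U := hball (by rwa [mem_ball, dist_eq_norm])
    have hwpos : ∀ i, 0 < w i := fun i => by simpa using hwU.1 i
    exact sub_eq_zero.2 (h w hwpos)
  intro ζ hζ
  have := han.eqOn_zero_of_preconnected_of_eventuallyEq_zero hUc h1 hev hζ
  exact sub_eq_zero.1 this

/-- **Gluing pairwise compatible holomorphic functions on a union of open sets.** [folklore] -/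
theorem exists_differentiableOn_iUnion_of_eqOn_inter {X : Type*} [NormedAddCommGroup X]
    [NormedSpace ℂ X] {E : Type*} [NormedAddCommGroup E] [NormedSpace ℂ E] {ι : Type*}
    (U : ι → Set X) (F : ι → X → E) (hU : ∀ i, IsOpen (U i))
    (hF : ∀ i, DifferentiableOn ℂ (F i) (U i)) (hagree : ∀ i j, EqOn (F i) (F j) (U i ∩ U j)) :
    ∃ G : X → E, DifferentiableOn ℂ G (⋃ i, U i) ∧ ∀ i, EqOn G (F i) (U i) := by
  classical
  set G : X → E := fun x => if h : ∃ i, x ∈ U i then F h.choose x else 0 with hG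
  have hGi : ∀ i, EqOn G (F i) (U i) := by
    intro i x hx
    have h : ∃ j, x ∈ U j := ⟨i, hx⟩
    simp only [hG, dif_pos h]
    exact hagree h.choose i ⟨h.choose_spec, hx⟩
  refine ⟨G, fun x hx => ?_, hGi⟩
  obtain ⟨i, hi⟩ := Set.mem_iUnion.1 hx
  have hd : DifferentiableAt ℂ (F i) x := (hF i).differentiableAt ((hU i).mem_nhds hi)
  have hev : G =ᶠ[𝓝 x] F i := by
    filter_upwards [(hU i).mem_nhds hi] with y hy using hGi i hy
  exact (hd.congr_of_eventuallyEq hev).differentiableWithinAt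

end Literature.Analysis.Complex
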